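import Summits.HodgeConjecture.HodgeConjecture.Theorems.Ring2WeilCoverageCMFieldCyclicCofactorForms
import Summits.HodgeConjecture.HodgeConjecture.Theorems.Ring2WeilCoverageCMFieldRationalPrimeRuleInstancesI
import Summits.HodgeConjecture.HodgeConjecture.Theorems.Ring2WeilCoverageCMFieldRationalPrimeRuleInstancesII
import Summits.HodgeConjecture.HodgeConjecture.Theorems.Ring2WeilCoverageCMFieldAllPrimesM
import HarnessLib

/-!
# Ring 2 — Weil-family coverage, CM-field rows: THE INTEGER ROWS `W8.E.[n]` of the biquadratic b03.29 tables, I — cofactor transfer and the `ℚ(ζ₂₄)`-fields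
  (WEIL-FAMILY-COVERAGE «## b03», cell (xxi⁵), part 29)

research route conditional on HC_CM; not a corollary; Q11.4-sentence-2 already refuted in dim ≥ 3.

On Deligne's carrier `R = S² + pS + q` (`F = ℚ(θ)`, `E = F(√θ)`, classes `[n] ∈ F^×/Nm_{E/F}(E^×)` labelled by their `T`-sets)
[cite: Deligne1982HodgeCycles, §4 p. 30, (1), Cor. 4.2] the biquadratic b03.29 fields `E = F(√b₀)` have their PRIMES
classified by parts 16–19 (`[ℓ] ≠ [1] ⟺ ℓ` in explicit classes mod `24 ∕ 40 ∕ 60`; every prime dividing `2·disc·b₀` is a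
norm).  Part IX-M's `natCast_eq_split_iff_even` turns this into the classification of ALL integer rows once each non-split
prime obstructs with a cofactor (`[ℓ·w] ≠ [1]`, `ℓ ∤ w`) — which the COFACTOR TRANSFER of §72 supplies uniformly: the odd bad place `v ∣ ℓ`
of part 12 stays bad for `ℓ·w` (`w` a `v`-unit).  This file: §72 the transfer (+ the `F(√-1)`, `F(√-2)` wrappers); §73–§76
the four `ℚ(ζ₂₄)`-fields `ℚ(i,√6)`, `ℚ(√-2,√3)`, `ℚ(√-3,√2)`, `ℚ(√-2,√-3)`: **`[n] = [1] ⟺` every non-split prime divides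
`n` to an even power; `[n₁] = [n₂] ⟺` equal parities.**  The sequel does the `ℚ(ζ₄₀)`- and `ℚ(ζ₆₀)`-fields.
No new definition, no named fact, no sorry; nothing about the Hodge conjecture is asserted (index-set bookkeeping only).
-/

noncomputable section

set_option linter.dupNamespace false

open Polynomial NumberField IsDedekindDomain

namespace Summit.HodgeConjecture.HodgeConjecture.Ring2.WeilCoverageCM

open Literature.AlgebraicGeometry.Deligne1982
open Literature.AlgebraicGeometry.HodgeTheory (splitDiscriminantClassCM)
open Literature.NumberTheory.QuadraticForms

variable {R : Polynomial ℤ} [Fact (Irreducible (cmPolyQ R))] [Fact (Irreducible (realPolyQ R))]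

/-! ### §72 COFACTOR TRANSFER: `[ℓ] ≠ [1] ⟹ [ℓ·w] ≠ [1]` for `ℓ ∤ w` (the bad place of part 12 stays bad) -/

/-- **COFACTOR TRANSFER.** Under the hypotheses of part 12's `mk_natCast_ne_splitDiscriminantClassCM_iff` (`θ = c²·b`,
`F` with one dyadic place, the odd places of `b` harmless for the prime `ℓ`): if `[ℓ] ≠ [(-1)^k₀]` (`k₀` even) then
**`[ℓ·w] ≠ [(-1)^k]` for every `w ∈ ℤ` with `ℓ ∤ w` and every even `k`** — the odd bad place `v ∤ 2b` of `ℓ` has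
`v ∋ ℓ`, so `w` is a `v`-unit and `ord_v(ℓw) = ord_v ℓ` is odd (O'Meara 63:11a). This is the input `hN` of part IX-M's
`natCast_eq_split_iff_even`. [cite: Deligne1982HodgeCycles, §4 (1) and Cor. 4.2] [cite: Omeara1963, §63B Cor. 63:11a
and §71D Thm. 71:18] -/
theorem mk_natCast_mul_ne_splitDiscriminantClassCM_of_ne
    (hroots : ∀ s : ℂ, Polynomial.eval₂ (Int.castRingHom ℂ) s R = 0 → s.im = 0 ∧ s.re < 0)
    {c : realField R} {b : 𝓞 (realField R)} (hfac : AdjoinRoot.root (realPolyQ R) = c ^ 2 * (b : realField R))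
    (huniq : ∀ v v' : HeightOneSpectrum (𝓞 (realField R)),
      (2 : 𝓞 (realField R)) ∈ v.asIdeal → (2 : 𝓞 (realField R)) ∈ v'.asIdeal → v = v')
    {ℓ : ℕ} (hℓ : ℓ.Prime)
    (hb : ∀ v : HeightOneSpectrum (𝓞 (realField R)), (2 : 𝓞 (realField R)) ∉ v.asIdeal → b ∈ v.asIdeal →
      (ℓ : 𝓞 (realField R)) ∉ v.asIdeal ∧
        (IsSquare (Ideal.Quotient.mk v.asIdeal (ℓ : 𝓞 (realField R))) ∨
          ¬ Odd (WithZero.log (v.valuation (realField R) (b : realField R)))))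
    (qℓ : (realField R)ˣ) (hqℓ : (qℓ : realField R) = ℓ) {k₀ : ℕ} (hk₀ : Even k₀)
    (hne : (QuotientGroup.mk qℓ : cmNormResidueGroup R) ≠ splitDiscriminantClassCM R k₀)
    {w : ℤ} (hw : ¬ (ℓ : ℤ) ∣ w) (q' : (realField R)ˣ) (hq' : (q' : realField R) = (ℓ : realField R) * (w : realField R))
    {k : ℕ} (hk : Even k) :
    (QuotientGroup.mk q' : cmNormResidueGroup R) ≠ splitDiscriminantClassCM R k := by
  obtain ⟨v, h2, hbv, hns, hodd⟩ := (mk_natCast_ne_splitDiscriminantClassCM_iff hroots hfac huniq hℓ hb qℓ hqℓ hk₀).1 hne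
  have hℓv : (ℓ : 𝓞 (realField R)) ∈ v.asIdeal := natCast_mem_of_odd_log_valuation v hodd
  obtain ⟨-, hw0⟩ := log_valuation_intCast_eq_zero_of_not_dvd v hℓ hℓv hw
  have hℓne : v.valuation (realField R) (ℓ : realField R) ≠ 0 :=
    (Valuation.ne_zero_iff _).2 (by exact_mod_cast hℓ.ne_zero)
  have hwz : w ≠ 0 := fun h ↦ hw (by rw [h]; exact dvd_zero _)
  have hwne : v.valuation (realField R) (w : realField R) ≠ 0 :=
    (Valuation.ne_zero_iff _).2 (by exact_mod_cast hwz)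
  have hmem : Sum.inl v ∈ badPlaces (q' : realField R) (AdjoinRoot.root (realPolyQ R)) := by
    rw [mem_badPlaces_iff, placeSymbol_inl,
      hilbertSymbol_adicCompletion_root_eq_neg_one_iff_of_eq_sq_mul_of_notMem hfac v h2 hbv (Units.ne_zero q'), hq',
      map_mul, WithZero.log_mul hℓne hwne, hw0, add_zero]
    exact ⟨hns, hodd⟩
  rw [Ne, mk_eq_splitDiscriminantClassCM_iff_badPlaces_eq_empty q' hk, Set.eq_empty_iff_forall_notMem]
  exact fun h ↦ h _ hmem

/-- **Cofactor transfer, `E = F(√-1)`** (`θ = -c²`; the radicand `-1` has no odd place). [cite: Deligne1982HodgeCycles,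
§4 (1) and Cor. 4.2] [cite: Omeara1963, §71D Thm. 71:18] -/
theorem mk_natCast_mul_ne_splitDiscriminantClassCM_of_ne_of_root_eq_neg_sq
    (hroots : ∀ s : ℂ, Polynomial.eval₂ (Int.castRingHom ℂ) s R = 0 → s.im = 0 ∧ s.re < 0)
    {c : realField R} (hfac : AdjoinRoot.root (realPolyQ R) = -c ^ 2)
    (huniq : ∀ v v' : HeightOneSpectrum (𝓞 (realField R)),
      (2 : 𝓞 (realField R)) ∈ v.asIdeal → (2 : 𝓞 (realField R)) ∈ v'.asIdeal → v = v')
    {ℓ : ℕ} (hℓ : ℓ.Prime) (qℓ : (realField R)ˣ) (hqℓ : (qℓ : realField R) = ℓ) {k₀ : ℕ} (hk₀ : Even k₀)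
    (hne : (QuotientGroup.mk qℓ : cmNormResidueGroup R) ≠ splitDiscriminantClassCM R k₀)
    {w : ℤ} (hw : ¬ (ℓ : ℤ) ∣ w) (q' : (realField R)ˣ) (hq' : (q' : realField R) = (ℓ : realField R) * (w : realField R))
    {k : ℕ} (hk : Even k) :
    (QuotientGroup.mk q' : cmNormResidueGroup R) ≠ splitDiscriminantClassCM R k := by
  have hfac' : AdjoinRoot.root (realPolyQ R) = c ^ 2 * (((-1 : ℤ) : 𝓞 (realField R)) : realField R) := by
    rw [hfac, show (((-1 : ℤ) : 𝓞 (realField R)) : realField R) = ((-1 : ℤ) : realField R) from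
      map_intCast (algebraMap (𝓞 (realField R)) (realField R)) _]
    push_cast; ring
  refine mk_natCast_mul_ne_splitDiscriminantClassCM_of_ne hroots hfac' huniq hℓ ?_ qℓ hqℓ hk₀ hne hw q' hq' hk
  intro v _ h1
  exfalso
  refine v.isPrime.ne_top ((Ideal.eq_top_iff_one _).2 ?_)
  have := v.asIdeal.neg_mem h1
  push_cast at this
  simpa using this

/-- **Cofactor transfer, `E = F(√-2)`** (`θ = -2c²`; the radicand `-2` has no odd place). [cite: Deligne1982HodgeCycles,
§4 (1) and Cor. 4.2] [cite: Omeara1963, §71D Thm. 71:18] -/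
theorem mk_natCast_mul_ne_splitDiscriminantClassCM_of_ne_of_root_eq_neg_two_mul_sq
    (hroots : ∀ s : ℂ, Polynomial.eval₂ (Int.castRingHom ℂ) s R = 0 → s.im = 0 ∧ s.re < 0)
    {c : realField R} (hfac : AdjoinRoot.root (realPolyQ R) = -2 * c ^ 2)
    (huniq : ∀ v v' : HeightOneSpectrum (𝓞 (realField R)),
      (2 : 𝓞 (realField R)) ∈ v.asIdeal → (2 : 𝓞 (realField R)) ∈ v'.asIdeal → v = v')
    {ℓ : ℕ} (hℓ : ℓ.Prime) (qℓ : (realField R)ˣ) (hqℓ : (qℓ : realField R) = ℓ) {k₀ : ℕ} (hk₀ : Even k₀)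
    (hne : (QuotientGroup.mk qℓ : cmNormResidueGroup R) ≠ splitDiscriminantClassCM R k₀)
    {w : ℤ} (hw : ¬ (ℓ : ℤ) ∣ w) (q' : (realField R)ˣ) (hq' : (q' : realField R) = (ℓ : realField R) * (w : realField R))
    {k : ℕ} (hk : Even k) :
    (QuotientGroup.mk q' : cmNormResidueGroup R) ≠ splitDiscriminantClassCM R k := by
  have hfac' : AdjoinRoot.root (realPolyQ R) = c ^ 2 * (((-2 : ℤ) : 𝓞 (realField R)) : realField R) := by
    rw [hfac, show (((-2 : ℤ) : 𝓞 (realField R)) : realField R) = ((-2 : ℤ) : realField R) from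
      map_intCast (algebraMap (𝓞 (realField R)) (realField R)) _]
    push_cast; ring
  refine mk_natCast_mul_ne_splitDiscriminantClassCM_of_ne hroots hfac' huniq hℓ ?_ qℓ hqℓ hk₀ hne hw q' hq' hk
  intro v h2 h1
  exfalso
  apply h2
  have := v.asIdeal.neg_mem h1
  push_cast at this
  simpa using this

/-! ### §73 `E = ℚ(i,√6)` (`R = S² + 14S + 25`, `F = ℚ(√6)`): non-split primes `ℓ % 24 = 19 ∨ ℓ % 24 = 23` -/
section IsqrtNeg1Sqrt6
/-- **Cofactor obstruction for `ℚ(i,√6)`**: for every non-split prime `ℓ` (`ℓ % 24 = 19 ∨ ℓ % 24 = 23`) and every `w ∈ ℤ` with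
`ℓ ∤ w`: `[ℓ·w] ≠ [(-1)^k]` (`k` even) — the inert degree-one place over `ℓ` of part 12 has `ord_v(ℓw) = ord_v ℓ` odd.
[cite: Deligne1982HodgeCycles, §4 (1) and Cor. 4.2] [cite: Omeara1963, §63B Example 63:12 and §71D Thm. 71:18] -/
theorem sqrtNeg1Sqrt6_mk_natCast_mul_ne_splitDiscriminantClassCM (hR : R = X ^ 2 + C 14 * X + C 25) {ℓ : ℕ} (hℓ : ℓ.Prime)
    (hS : ℓ % 24 = 19 ∨ ℓ % 24 = 23) {w : ℤ} (hw : ¬ (ℓ : ℤ) ∣ w) (qℓ : (realField R)ˣ)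
    (hqℓ : (qℓ : realField R) = (ℓ : realField R) * (w : realField R)) {k : ℕ} (hk : Even k) :
    (QuotientGroup.mk qℓ : cmNormResidueGroup R) ≠ splitDiscriminantClassCM R k := by
  haveI := Fact.mk hℓ
  have hroots := roots_real_neg_of_quadratic hR (by norm_num) (by norm_num) (by norm_num)
  have hrel := root_rel_quadratic hR
  push_cast at hrel
  have hℓ0 : (ℓ : realField R) ≠ 0 := by exact_mod_cast hℓ.ne_zero
  have hne := (sqrtNeg1Sqrt6_mk_prime_ne_splitDiscriminantClassCM_iff_mod hR hℓ (Units.mk0 _ hℓ0) (Units.val_mk0 _)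
    even_two).2 hS
  have hfac : AdjoinRoot.root (realPolyQ R) = -((-5/2 : realField R) + (-1/2 : realField R) * AdjoinRoot.root (realPolyQ R)) ^ 2 := by
    linear_combination (1/4 : realField R) * hrel
  exact mk_natCast_mul_ne_splitDiscriminantClassCM_of_ne_of_root_eq_neg_sq hroots hfac (sqrtNeg1Sqrt6_ratPrimeRule_dyadic_unique hR)
    hℓ (Units.mk0 _ hℓ0) (Units.val_mk0 _) even_two hne hw qℓ hqℓ hk

/-- **THE INTEGER ROWS of the `ℚ(i,√6)` table**: for `n ≥ 1`, **`[n] = [1] ⟺` every prime `ℓ` with `ℓ % 24 = 19 ∨ ℓ % 24 = 23` divides `n`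
to an EVEN power** (part IX-M's induction; no exceptional prime). [cite: Deligne1982HodgeCycles, §4 (1) and Cor. 4.2]
[cite: Landherr1936HermitianForms] -/
theorem sqrtNeg1Sqrt6_natCast_eq_splitDiscriminantClassCM_iff (hR : R = X ^ 2 + C 14 * X + C 25) (n : ℕ) (hn : 1 ≤ n)
    (v : (realField R)ˣ) (hv : (v : realField R) = n) :
    (QuotientGroup.mk v : cmNormResidueGroup R) = splitDiscriminantClassCM R 2 ↔
      ∀ ℓ : ℕ, ℓ.Prime → (ℓ % 24 = 19 ∨ ℓ % 24 = 23) → Even (n.factorization ℓ) := by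
  refine (natCast_eq_split_iff_even (fun ℓ ↦ ¬ (ℓ % 24 = 19 ∨ ℓ % 24 = 23)) 1 ?_ (fun h ↦ absurd h Nat.not_prime_one) ?_ n hn v
    hv).trans (forall_congr' fun ℓ ↦ forall_congr' fun _ ↦ by simp only [not_not])
  · intro ℓ hℓ hs u hu
    by_contra hne
    exact hs ((sqrtNeg1Sqrt6_mk_prime_ne_splitDiscriminantClassCM_iff_mod hR hℓ u hu even_two).1 hne)
  · intro ℓ hℓ hs _ w hw u hu
    exact sqrtNeg1Sqrt6_mk_natCast_mul_ne_splitDiscriminantClassCM hR hℓ (not_not.1 hs) hw u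
      (by rw [hu, map_mul, map_natCast, map_intCast]) even_two

/-- **ROW STRUCTURE of the `ℚ(i,√6)` table**: `[n₁] = [n₂] ⟺` the primes `ℓ` with `ℓ % 24 = 19 ∨ ℓ % 24 = 23` occur in `n₁`, `n₂` with
exponents of the same parity. [cite: Deligne1982HodgeCycles, §4 (1) and Cor. 4.2] [cite: Landherr1936HermitianForms] -/
theorem sqrtNeg1Sqrt6_natCast_mk_eq_mk_iff (hR : R = X ^ 2 + C 14 * X + C 25) {n₁ n₂ : ℕ} (hn₁ : 1 ≤ n₁) (hn₂ : 1 ≤ n₂)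
    (u v : (realField R)ˣ) (hu : (u : realField R) = n₁) (hv : (v : realField R) = n₂) :
    (QuotientGroup.mk u : cmNormResidueGroup R) = QuotientGroup.mk v ↔
      ∀ ℓ : ℕ, ℓ.Prime → (ℓ % 24 = 19 ∨ ℓ % 24 = 23) → (Even (n₁.factorization ℓ) ↔ Even (n₂.factorization ℓ)) := by
  refine (natCast_mk_eq_mk_iff_even (fun ℓ ↦ ¬ (ℓ % 24 = 19 ∨ ℓ % 24 = 23)) 1 ?_ (fun h ↦ absurd h Nat.not_prime_one) ?_ hn₁ hn₂
    u v hu hv).trans (forall_congr' fun ℓ ↦ forall_congr' fun _ ↦ by simp only [not_not])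
  · intro ℓ hℓ hs u hu
    by_contra hne
    exact hs ((sqrtNeg1Sqrt6_mk_prime_ne_splitDiscriminantClassCM_iff_mod hR hℓ u hu even_two).1 hne)
  · intro ℓ hℓ hs _ w hw u hu
    exact sqrtNeg1Sqrt6_mk_natCast_mul_ne_splitDiscriminantClassCM hR hℓ (not_not.1 hs) hw u
      (by rw [hu, map_mul, map_natCast, map_intCast]) even_two

end IsqrtNeg1Sqrt6

/-! ### §74 `E = ℚ(√-2,√3)` (`R = S² + 16S + 16`, `F = ℚ(√3)`): non-split primes `ℓ % 24 = 13 ∨ ℓ % 24 = 23` -/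
section IsqrtNeg2Sqrt3
/-- **Cofactor obstruction for `ℚ(√-2,√3)`**: for every non-split prime `ℓ` (`ℓ % 24 = 13 ∨ ℓ % 24 = 23`) and every `w ∈ ℤ` with
`ℓ ∤ w`: `[ℓ·w] ≠ [(-1)^k]` (`k` even) — the inert degree-one place over `ℓ` of part 12 has `ord_v(ℓw) = ord_v ℓ` odd.
[cite: Deligne1982HodgeCycles, §4 (1) and Cor. 4.2] [cite: Omeara1963, §63B Example 63:12 and §71D Thm. 71:18] -/
theorem sqrtNeg2Sqrt3_mk_natCast_mul_ne_splitDiscriminantClassCM (hR : R = X ^ 2 + C 16 * X + C 16) {ℓ : ℕ} (hℓ : ℓ.Prime)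
    (hS : ℓ % 24 = 13 ∨ ℓ % 24 = 23) {w : ℤ} (hw : ¬ (ℓ : ℤ) ∣ w) (qℓ : (realField R)ˣ)
    (hqℓ : (qℓ : realField R) = (ℓ : realField R) * (w : realField R)) {k : ℕ} (hk : Even k) :
    (QuotientGroup.mk qℓ : cmNormResidueGroup R) ≠ splitDiscriminantClassCM R k := by
  haveI := Fact.mk hℓ
  have hroots := roots_real_neg_of_quadratic hR (by norm_num) (by norm_num) (by norm_num)
  have hrel := root_rel_quadratic hR
  push_cast at hrel
  have hℓ0 : (ℓ : realField R) ≠ 0 := by exact_mod_cast hℓ.ne_zero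
  have hne := (sqrtNeg2Sqrt3_mk_prime_ne_splitDiscriminantClassCM_iff_mod hR hℓ (Units.mk0 _ hℓ0) (Units.val_mk0 _)
    even_two).2 hS
  have hfac : AdjoinRoot.root (realPolyQ R) = -2 * ((-1 : realField R) + (-1/4 : realField R) * AdjoinRoot.root (realPolyQ R)) ^ 2 := by
    linear_combination (1/8 : realField R) * hrel
  exact mk_natCast_mul_ne_splitDiscriminantClassCM_of_ne_of_root_eq_neg_two_mul_sq hroots hfac
    (sqrtNeg2Sqrt3_ratPrimeRule_dyadic_unique hR) hℓ (Units.mk0 _ hℓ0) (Units.val_mk0 _) even_two hne hw qℓ hqℓ hk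

/-- **THE INTEGER ROWS of the `ℚ(√-2,√3)` table**: for `n ≥ 1`, **`[n] = [1] ⟺` every prime `ℓ` with `ℓ % 24 = 13 ∨ ℓ % 24 = 23` divides `n`
to an EVEN power** (part IX-M's induction; no exceptional prime). [cite: Deligne1982HodgeCycles, §4 (1) and Cor. 4.2]
[cite: Landherr1936HermitianForms] -/
theorem sqrtNeg2Sqrt3_natCast_eq_splitDiscriminantClassCM_iff (hR : R = X ^ 2 + C 16 * X + C 16) (n : ℕ) (hn : 1 ≤ n)
    (v : (realField R)ˣ) (hv : (v : realField R) = n) :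
    (QuotientGroup.mk v : cmNormResidueGroup R) = splitDiscriminantClassCM R 2 ↔
      ∀ ℓ : ℕ, ℓ.Prime → (ℓ % 24 = 13 ∨ ℓ % 24 = 23) → Even (n.factorization ℓ) := by
  refine (natCast_eq_split_iff_even (fun ℓ ↦ ¬ (ℓ % 24 = 13 ∨ ℓ % 24 = 23)) 1 ?_ (fun h ↦ absurd h Nat.not_prime_one) ?_ n hn v
    hv).trans (forall_congr' fun ℓ ↦ forall_congr' fun _ ↦ by simp only [not_not])
  · intro ℓ hℓ hs u hu
    by_contra hne
    exact hs ((sqrtNeg2Sqrt3_mk_prime_ne_splitDiscriminantClassCM_iff_mod hR hℓ u hu even_two).1 hne)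
  · intro ℓ hℓ hs _ w hw u hu
    exact sqrtNeg2Sqrt3_mk_natCast_mul_ne_splitDiscriminantClassCM hR hℓ (not_not.1 hs) hw u
      (by rw [hu, map_mul, map_natCast, map_intCast]) even_two

/-- **ROW STRUCTURE of the `ℚ(√-2,√3)` table**: `[n₁] = [n₂] ⟺` the primes `ℓ` with `ℓ % 24 = 13 ∨ ℓ % 24 = 23` occur in `n₁`, `n₂` with
exponents of the same parity. [cite: Deligne1982HodgeCycles, §4 (1) and Cor. 4.2] [cite: Landherr1936HermitianForms] -/
theorem sqrtNeg2Sqrt3_natCast_mk_eq_mk_iff (hR : R = X ^ 2 + C 16 * X + C 16) {n₁ n₂ : ℕ} (hn₁ : 1 ≤ n₁) (hn₂ : 1 ≤ n₂)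
    (u v : (realField R)ˣ) (hu : (u : realField R) = n₁) (hv : (v : realField R) = n₂) :
    (QuotientGroup.mk u : cmNormResidueGroup R) = QuotientGroup.mk v ↔
      ∀ ℓ : ℕ, ℓ.Prime → (ℓ % 24 = 13 ∨ ℓ % 24 = 23) → (Even (n₁.factorization ℓ) ↔ Even (n₂.factorization ℓ)) := by
  refine (natCast_mk_eq_mk_iff_even (fun ℓ ↦ ¬ (ℓ % 24 = 13 ∨ ℓ % 24 = 23)) 1 ?_ (fun h ↦ absurd h Nat.not_prime_one) ?_ hn₁ hn₂
    u v hu hv).trans (forall_congr' fun ℓ ↦ forall_congr' fun _ ↦ by simp only [not_not])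
  · intro ℓ hℓ hs u hu
    by_contra hne
    exact hs ((sqrtNeg2Sqrt3_mk_prime_ne_splitDiscriminantClassCM_iff_mod hR hℓ u hu even_two).1 hne)
  · intro ℓ hℓ hs _ w hw u hu
    exact sqrtNeg2Sqrt3_mk_natCast_mul_ne_splitDiscriminantClassCM hR hℓ (not_not.1 hs) hw u
      (by rw [hu, map_mul, map_natCast, map_intCast]) even_two

end IsqrtNeg2Sqrt3

/-! ### §75 `E = ℚ(√-3,√2)` (`R = S² + 18S + 9`, `F = ℚ(√2)`): non-split primes `ℓ % 24 = 17 ∨ ℓ % 24 = 23` -/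
section IsqrtNeg3Sqrt2
/-- **Cofactor obstruction for `ℚ(√-3,√2)`**: for every non-split prime `ℓ` (`ℓ % 24 = 17 ∨ ℓ % 24 = 23`) and every `w ∈ ℤ` with
`ℓ ∤ w`: `[ℓ·w] ≠ [(-1)^k]` (`k` even) — the inert degree-one place over `ℓ` of part 12 has `ord_v(ℓw) = ord_v ℓ` odd.
[cite: Deligne1982HodgeCycles, §4 (1) and Cor. 4.2] [cite: Omeara1963, §63B Example 63:12 and §71D Thm. 71:18] -/
theorem sqrtNeg3Sqrt2_mk_natCast_mul_ne_splitDiscriminantClassCM (hR : R = X ^ 2 + C 18 * X + C 9) {ℓ : ℕ} (hℓ : ℓ.Prime)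
    (hS : ℓ % 24 = 17 ∨ ℓ % 24 = 23) {w : ℤ} (hw : ¬ (ℓ : ℤ) ∣ w) (qℓ : (realField R)ˣ)
    (hqℓ : (qℓ : realField R) = (ℓ : realField R) * (w : realField R)) {k : ℕ} (hk : Even k) :
    (QuotientGroup.mk qℓ : cmNormResidueGroup R) ≠ splitDiscriminantClassCM R k := by
  have hnsq : ¬ IsSquare (((2 : ℤ) : ℤ) : ZMod 3) := by decide
  have hp0 : ℓ ≠ 3 := by omega
  haveI := Fact.mk hℓ
  have hroots := roots_real_neg_of_quadratic hR (by norm_num) (by norm_num) (by norm_num)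
  have hrel := root_rel_quadratic hR
  push_cast at hrel
  have hℓ0 : (ℓ : realField R) ≠ 0 := by exact_mod_cast hℓ.ne_zero
  have hne := (sqrtNeg3Sqrt2_mk_prime_ne_splitDiscriminantClassCM_iff_mod hR hℓ (Units.mk0 _ hℓ0) (Units.val_mk0 _)
    even_two).2 hS
  obtain ⟨s, -, hs⟩ := sqrtNeg3Sqrt2_ratPrimeRule_exists_sq_eq_2 hR
  have hs' : s ^ 2 = ((2 : ℤ) : 𝓞 (realField R)) := by rw [hs]; norm_num
  have hb := radicand_places_of_inert (finrank_realField_quadratic hR) hs' Nat.prime_three hnsq hℓ hp0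
  have hfac : AdjoinRoot.root (realPolyQ R) = ((-1/2 : realField R) + (-1/6 : realField R) * AdjoinRoot.root (realPolyQ R)) ^ 2 * (((-(3 : ℕ) : ℤ) : 𝓞 (realField R)) : realField R) := by
    rw [show (((-(3 : ℕ) : ℤ) : 𝓞 (realField R)) : realField R) = ((-(3 : ℕ) : ℤ) : realField R) from
      map_intCast (algebraMap (𝓞 (realField R)) (realField R)) _]
    push_cast
    linear_combination (1/12 : realField R) * hrel
  exact mk_natCast_mul_ne_splitDiscriminantClassCM_of_ne hroots hfac (sqrtNeg3Sqrt2_ratPrimeRule_dyadic_unique hR) hℓ hb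
    (Units.mk0 _ hℓ0) (Units.val_mk0 _) even_two hne hw qℓ hqℓ hk

/-- **THE INTEGER ROWS of the `ℚ(√-3,√2)` table**: for `n ≥ 1`, **`[n] = [1] ⟺` every prime `ℓ` with `ℓ % 24 = 17 ∨ ℓ % 24 = 23` divides `n`
to an EVEN power** (part IX-M's induction; no exceptional prime). [cite: Deligne1982HodgeCycles, §4 (1) and Cor. 4.2]
[cite: Landherr1936HermitianForms] -/
theorem sqrtNeg3Sqrt2_natCast_eq_splitDiscriminantClassCM_iff (hR : R = X ^ 2 + C 18 * X + C 9) (n : ℕ) (hn : 1 ≤ n)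
    (v : (realField R)ˣ) (hv : (v : realField R) = n) :
    (QuotientGroup.mk v : cmNormResidueGroup R) = splitDiscriminantClassCM R 2 ↔
      ∀ ℓ : ℕ, ℓ.Prime → (ℓ % 24 = 17 ∨ ℓ % 24 = 23) → Even (n.factorization ℓ) := by
  refine (natCast_eq_split_iff_even (fun ℓ ↦ ¬ (ℓ % 24 = 17 ∨ ℓ % 24 = 23)) 1 ?_ (fun h ↦ absurd h Nat.not_prime_one) ?_ n hn v
    hv).trans (forall_congr' fun ℓ ↦ forall_congr' fun _ ↦ by simp only [not_not])
  · intro ℓ hℓ hs u hu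
    by_contra hne
    exact hs ((sqrtNeg3Sqrt2_mk_prime_ne_splitDiscriminantClassCM_iff_mod hR hℓ u hu even_two).1 hne)
  · intro ℓ hℓ hs _ w hw u hu
    exact sqrtNeg3Sqrt2_mk_natCast_mul_ne_splitDiscriminantClassCM hR hℓ (not_not.1 hs) hw u
      (by rw [hu, map_mul, map_natCast, map_intCast]) even_two

/-- **ROW STRUCTURE of the `ℚ(√-3,√2)` table**: `[n₁] = [n₂] ⟺` the primes `ℓ` with `ℓ % 24 = 17 ∨ ℓ % 24 = 23` occur in `n₁`, `n₂` with
exponents of the same parity. [cite: Deligne1982HodgeCycles, §4 (1) and Cor. 4.2] [cite: Landherr1936HermitianForms] -/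
theorem sqrtNeg3Sqrt2_natCast_mk_eq_mk_iff (hR : R = X ^ 2 + C 18 * X + C 9) {n₁ n₂ : ℕ} (hn₁ : 1 ≤ n₁) (hn₂ : 1 ≤ n₂)
    (u v : (realField R)ˣ) (hu : (u : realField R) = n₁) (hv : (v : realField R) = n₂) :
    (QuotientGroup.mk u : cmNormResidueGroup R) = QuotientGroup.mk v ↔
      ∀ ℓ : ℕ, ℓ.Prime → (ℓ % 24 = 17 ∨ ℓ % 24 = 23) → (Even (n₁.factorization ℓ) ↔ Even (n₂.factorization ℓ)) := by
  refine (natCast_mk_eq_mk_iff_even (fun ℓ ↦ ¬ (ℓ % 24 = 17 ∨ ℓ % 24 = 23)) 1 ?_ (fun h ↦ absurd h Nat.not_prime_one) ?_ hn₁ hn₂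
    u v hu hv).trans (forall_congr' fun ℓ ↦ forall_congr' fun _ ↦ by simp only [not_not])
  · intro ℓ hℓ hs u hu
    by_contra hne
    exact hs ((sqrtNeg3Sqrt2_mk_prime_ne_splitDiscriminantClassCM_iff_mod hR hℓ u hu even_two).1 hne)
  · intro ℓ hℓ hs _ w hw u hu
    exact sqrtNeg3Sqrt2_mk_natCast_mul_ne_splitDiscriminantClassCM hR hℓ (not_not.1 hs) hw u
      (by rw [hu, map_mul, map_natCast, map_intCast]) even_two

end IsqrtNeg3Sqrt2

/-! ### §76 `E = ℚ(√-2,√-3)` (`R = S² + 10S + 1`, `F = ℚ(√6)`): non-split primes `ℓ % 24 = 5 ∨ ℓ % 24 = 23` -/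
section IsqrtNeg2SqrtNeg3
/-- **Cofactor obstruction for `ℚ(√-2,√-3)`**: for every non-split prime `ℓ` (`ℓ % 24 = 5 ∨ ℓ % 24 = 23`) and every `w ∈ ℤ` with
`ℓ ∤ w`: `[ℓ·w] ≠ [(-1)^k]` (`k` even) — the inert degree-one place over `ℓ` of part 12 has `ord_v(ℓw) = ord_v ℓ` odd.
[cite: Deligne1982HodgeCycles, §4 (1) and Cor. 4.2] [cite: Omeara1963, §63B Example 63:12 and §71D Thm. 71:18] -/
theorem sqrtNeg2SqrtNeg3_mk_natCast_mul_ne_splitDiscriminantClassCM (hR : R = X ^ 2 + C 10 * X + C 1) {ℓ : ℕ} (hℓ : ℓ.Prime)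
    (hS : ℓ % 24 = 5 ∨ ℓ % 24 = 23) {w : ℤ} (hw : ¬ (ℓ : ℤ) ∣ w) (qℓ : (realField R)ˣ)
    (hqℓ : (qℓ : realField R) = (ℓ : realField R) * (w : realField R)) {k : ℕ} (hk : Even k) :
    (QuotientGroup.mk qℓ : cmNormResidueGroup R) ≠ splitDiscriminantClassCM R k := by
  haveI := Fact.mk hℓ
  have hroots := roots_real_neg_of_quadratic hR (by norm_num) (by norm_num) (by norm_num)
  have hrel := root_rel_quadratic hR
  push_cast at hrel
  have hℓ0 : (ℓ : realField R) ≠ 0 := by exact_mod_cast hℓ.ne_zero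
  have hne := (sqrtNeg2SqrtNeg3_mk_prime_ne_splitDiscriminantClassCM_iff_mod hR hℓ (Units.mk0 _ hℓ0) (Units.val_mk0 _)
    even_two).2 hS
  have hfac : AdjoinRoot.root (realPolyQ R) = -2 * ((-1/4 : realField R) + (-1/4 : realField R) * AdjoinRoot.root (realPolyQ R)) ^ 2 := by
    linear_combination (1/8 : realField R) * hrel
  exact mk_natCast_mul_ne_splitDiscriminantClassCM_of_ne_of_root_eq_neg_two_mul_sq hroots hfac
    (sqrtNeg2SqrtNeg3_ratPrimeRule_dyadic_unique hR) hℓ (Units.mk0 _ hℓ0) (Units.val_mk0 _) even_two hne hw qℓ hqℓ hk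

/-- **THE INTEGER ROWS of the `ℚ(√-2,√-3)` table**: for `n ≥ 1`, **`[n] = [1] ⟺` every prime `ℓ` with `ℓ % 24 = 5 ∨ ℓ % 24 = 23` divides `n`
to an EVEN power** (part IX-M's induction; no exceptional prime). [cite: Deligne1982HodgeCycles, §4 (1) and Cor. 4.2]
[cite: Landherr1936HermitianForms] -/
theorem sqrtNeg2SqrtNeg3_natCast_eq_splitDiscriminantClassCM_iff (hR : R = X ^ 2 + C 10 * X + C 1) (n : ℕ) (hn : 1 ≤ n)
    (v : (realField R)ˣ) (hv : (v : realField R) = n) :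
    (QuotientGroup.mk v : cmNormResidueGroup R) = splitDiscriminantClassCM R 2 ↔
      ∀ ℓ : ℕ, ℓ.Prime → (ℓ % 24 = 5 ∨ ℓ % 24 = 23) → Even (n.factorization ℓ) := by
  refine (natCast_eq_split_iff_even (fun ℓ ↦ ¬ (ℓ % 24 = 5 ∨ ℓ % 24 = 23)) 1 ?_ (fun h ↦ absurd h Nat.not_prime_one) ?_ n hn v
    hv).trans (forall_congr' fun ℓ ↦ forall_congr' fun _ ↦ by simp only [not_not])
  · intro ℓ hℓ hs u hu
    by_contra hne
    exact hs ((sqrtNeg2SqrtNeg3_mk_prime_ne_splitDiscriminantClassCM_iff_mod hR hℓ u hu even_two).1 hne)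
  · intro ℓ hℓ hs _ w hw u hu
    exact sqrtNeg2SqrtNeg3_mk_natCast_mul_ne_splitDiscriminantClassCM hR hℓ (not_not.1 hs) hw u
      (by rw [hu, map_mul, map_natCast, map_intCast]) even_two

/-- **ROW STRUCTURE of the `ℚ(√-2,√-3)` table**: `[n₁] = [n₂] ⟺` the primes `ℓ` with `ℓ % 24 = 5 ∨ ℓ % 24 = 23` occur in `n₁`, `n₂` with
exponents of the same parity. [cite: Deligne1982HodgeCycles, §4 (1) and Cor. 4.2] [cite: Landherr1936HermitianForms] -/
theorem sqrtNeg2SqrtNeg3_natCast_mk_eq_mk_iff (hR : R = X ^ 2 + C 10 * X + C 1) {n₁ n₂ : ℕ} (hn₁ : 1 ≤ n₁) (hn₂ : 1 ≤ n₂)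
    (u v : (realField R)ˣ) (hu : (u : realField R) = n₁) (hv : (v : realField R) = n₂) :
    (QuotientGroup.mk u : cmNormResidueGroup R) = QuotientGroup.mk v ↔
      ∀ ℓ : ℕ, ℓ.Prime → (ℓ % 24 = 5 ∨ ℓ % 24 = 23) → (Even (n₁.factorization ℓ) ↔ Even (n₂.factorization ℓ)) := by
  refine (natCast_mk_eq_mk_iff_even (fun ℓ ↦ ¬ (ℓ % 24 = 5 ∨ ℓ % 24 = 23)) 1 ?_ (fun h ↦ absurd h Nat.not_prime_one) ?_ hn₁ hn₂
    u v hu hv).trans (forall_congr' fun ℓ ↦ forall_congr' fun _ ↦ by simp only [not_not])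
  · intro ℓ hℓ hs u hu
    by_contra hne
    exact hs ((sqrtNeg2SqrtNeg3_mk_prime_ne_splitDiscriminantClassCM_iff_mod hR hℓ u hu even_two).1 hne)
  · intro ℓ hℓ hs _ w hw u hu
    exact sqrtNeg2SqrtNeg3_mk_natCast_mul_ne_splitDiscriminantClassCM hR hℓ (not_not.1 hs) hw u
      (by rw [hu, map_mul, map_natCast, map_intCast]) even_two

end IsqrtNeg2SqrtNeg3

end Summit.HodgeConjecture.HodgeConjecture.Ring2.WeilCoverageCM

end
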